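import Summits.AtomisticToContinuum.Crystallization.Theorems.FreeSplittingCertificatesStrictSplittingRuleFarPencilFlux4Growth
import Summits.AtomisticToContinuum.Crystallization.Theorems.FreeSplittingCertificatesStrictSplittingRuleFarPencilLocallyAffine

/-!
# `StrictSplittingRule` (stmt-AtomisticToContinuum-12560): the weighted far pencil for the GENERIC flux on the P1 class (Lipschitz, locally affine, affine tail)

Route `FreeSplittingCertificates`, crux r3 `StrictSplittingRule` (H12⋆ = `stub_coreJointCoercive`), unit b2b-freesplit-B gen 18.
VALUE = companion 3/3 of `…FarPencilFlux4.lean`: the density argument of `…FarPencilLocallyAffine` (gen 12, written for the ONE flux `fpFlux`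
of the `17/200` pencil) re-run for the generic flux `fpFlux4 a b c n = aΦ₁ + bΦ₂ + cΦ₃ + nΨ₁`, the inflated demand `fpNumI f_S f_A D C` and
ANY pointwise certificate `N + div Φ ≤ t·Den` — so that the continuum far theorem is available, in the generality the lattice→continuum transfer
consumes (continuous piecewise-affine interpolants), for the inflated certificate D the assembly of H12⋆ cites (HOME CERT.md §23,
FAR-LEMMA-SPEC §14 (e) item (6)).  NOT a proof of H12⋆, NOT summit progress.

Content:
* uniform bounds `|N(f_S,f_A,D,C)(x,w,G)| ≤ c₃K²|x|⁻⁶ + c₄V²|x|⁻⁸` and `|Φⱼ(y)| ≤ (3|a|+3|b|+9|c|)|y|⁻⁸‖y‖W² + 6|n|K|y|⁻⁶W` under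
  `|Gᵢⱼ| ≤ K`, `‖w‖ ≤ V + K‖x‖` / `‖v y‖ ≤ W` (`abs_fpNumI_le`, `abs_fpFlux4_le`; the radial flux `Φ₃` is folded in by `|y|⁻²‖y‖² ≤ 1`);
* measurability of the three weighted integrands for an arbitrary continuous field (`fderiv` is Borel);
* **`farPencil4_weighted_integral_le_of_locallyAffine`**: `v` `K`-Lipschitz, affine near every point off a null set `S`, affine
  (`v = b₀ + y·A`) for `‖y‖ ≥ R`; `χ ∈ C²` vanishing near `0`, `= 1` for `‖y‖ ≥ R`; pointwise certificate with receipts coefficient `t`.  Then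
  `∫ χ²·N(v) ≤ t·∫ χ²·Den(v) + ∫ 2χ⟪∇χ, Φ(v)⟫` (mollify — `φ̃_δ ⋆ v` is `C²`, `K`-Lipschitz, same affine tail beyond `R + 1` —, apply
  `farPencil4_weighted_integral_le_of_affineTail`, let `δ → 0` by dominated convergence: integrands eventually constant off `S`);
* `farPencilD_weighted_integral_le_of_locallyAffine`: the instance for the recommended certificate D (`t = 9/40`).
HONEST FRAMING: theorems about continuum fields; the interpolant object, the element receipts/readout transfer, the flux identification and the
near certificate are separate items; NOT a proof of H12⋆, NOT summit progress.
-/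

noncomputable section

open MeasureTheory Topology Filter Asymptotics ContinuousLinearMap Metric
open scoped Convolution NNReal

namespace Summit.AtomisticToContinuum.Crystallization.Theorems.StrictSplittingRuleBirth

/-! ## Uniform bounds on the generic densities -/

/-- **Inflated demand density bound**: `|N(f_S,f_A,D,C)(x,w,G)| ≤ (3(|f_S|+|f_A|)/8 + 3(|7D+C|+|C|)/2)K²|x|⁻⁶ + (3(|7D+C|+|C|)/2)V²|x|⁻⁸`
when `|Gᵢⱼ| ≤ K` and `‖w‖ ≤ V + K‖x‖`. -/
theorem abs_fpNumI_le (fS fA D C : ℝ) {x w : Fin 3 → ℝ} {G : Fin 3 → Fin 3 → ℝ} {K V : ℝ}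
    (hG : ∀ i j, |G i j| ≤ K) (hw : ‖w‖ ≤ V + K * ‖x‖) :
    |fpNumI fS fA D C x w G| ≤
      (3 / 8 * (|fS| + |fA|) + 3 / 2 * (|7 * D + C| + |C|)) * K ^ 2 * (fpSq x)⁻¹ ^ 3 +
        3 / 2 * (|7 * D + C| + |C|) * V ^ 2 * (fpSq x)⁻¹ ^ 4 := by
  set t := (fpSq x)⁻¹ with ht
  have ht0 : 0 ≤ t := inv_nonneg.2 (fpSq_nonneg x)
  have hst : fpSq x * t ≤ 1 := fpSq_mul_inv_le_one x
  have hfrob := fpFrob_le_of_abs_le hG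
  have hsym0 : 0 ≤ fpSymSq G := fpSymSq_nonneg G
  have hanti0 : 0 ≤ fpFrob G - fpSymSq G := fpFrob_sub_fpSymSq_nonneg G
  have hws := fpSq_le_of_norm_le hw
  have hw0 : 0 ≤ fpSq w := fpSq_nonneg w
  have hw' : w 0 ^ 2 + w 1 ^ 2 + w 2 ^ 2 = fpSq w := rfl
  have hdot := fpDot_sq_le x w
  -- the common estimate `t⁴|w|² ≤ 6V²t⁴ + 6K²t³` and `t⁵⟪x,w⟫² ≤ t⁴|w|²`
  have a2 : t ^ 4 * fpSq w ≤ 6 * V ^ 2 * t ^ 4 + 6 * K ^ 2 * t ^ 3 := by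
    calc t ^ 4 * fpSq w ≤ t ^ 4 * (6 * V ^ 2 + 6 * K ^ 2 * fpSq x) := mul_le_mul_of_nonneg_left hws (pow_nonneg ht0 4)
      _ = 6 * V ^ 2 * t ^ 4 + 6 * K ^ 2 * t ^ 3 * (fpSq x * t) := by ring
      _ ≤ 6 * V ^ 2 * t ^ 4 + 6 * K ^ 2 * t ^ 3 * 1 := by gcongr
      _ = 6 * V ^ 2 * t ^ 4 + 6 * K ^ 2 * t ^ 3 := by ring
  have a1 : t ^ 5 * fpDot x w ^ 2 ≤ t ^ 4 * fpSq w := by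
    calc t ^ 5 * fpDot x w ^ 2 ≤ t ^ 5 * (fpSq x * fpSq w) := mul_le_mul_of_nonneg_left hdot (pow_nonneg ht0 5)
      _ = t ^ 4 * fpSq w * (fpSq x * t) := by ring
      _ ≤ t ^ 4 * fpSq w * 1 := mul_le_mul_of_nonneg_left hst (by positivity)
      _ = t ^ 4 * fpSq w := by ring
  -- the four terms
  have h1 : |fS * (1 / 24 * t ^ 3 * fpSymSq G)| ≤ 3 / 8 * |fS| * K ^ 2 * t ^ 3 := by
    rw [abs_mul, abs_of_nonneg (by positivity : (0:ℝ) ≤ 1 / 24 * t ^ 3 * fpSymSq G)]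
    have : fpSymSq G ≤ 9 * K ^ 2 := by linarith
    have : 1 / 24 * t ^ 3 * fpSymSq G ≤ 1 / 24 * t ^ 3 * (9 * K ^ 2) := by gcongr
    nlinarith [abs_nonneg fS]
  have h2 : |fA * (1 / 24 * t ^ 3 * (fpFrob G - fpSymSq G))| ≤ 3 / 8 * |fA| * K ^ 2 * t ^ 3 := by
    rw [abs_mul, abs_of_nonneg (by positivity : (0:ℝ) ≤ 1 / 24 * t ^ 3 * (fpFrob G - fpSymSq G))]
    have : fpFrob G - fpSymSq G ≤ 9 * K ^ 2 := by linarith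
    have : 1 / 24 * t ^ 3 * (fpFrob G - fpSymSq G) ≤ 1 / 24 * t ^ 3 * (9 * K ^ 2) := by gcongr
    nlinarith [abs_nonneg fA]
  have a3 : t ^ 5 * fpDot x w ^ 2 ≤ 6 * V ^ 2 * t ^ 4 + 6 * K ^ 2 * t ^ 3 := a1.trans a2
  have h3 : |(7 * D + C) / 4 * t ^ 5 * fpDot x w ^ 2| ≤ 3 / 2 * |7 * D + C| * (V ^ 2 * t ^ 4 + K ^ 2 * t ^ 3) := by
    have e : (7 * D + C) / 4 * t ^ 5 * fpDot x w ^ 2 = (7 * D + C) / 4 * (t ^ 5 * fpDot x w ^ 2) := by ring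
    rw [e, abs_mul ((7 * D + C) / 4), abs_div (7 * D + C) 4, abs_of_pos (by norm_num : (0:ℝ) < 4),
      abs_of_nonneg (mul_nonneg (pow_nonneg ht0 5) (sq_nonneg (fpDot x w)))]
    have h := mul_le_mul_of_nonneg_left a3 (abs_nonneg (7 * D + C))
    linarith
  have h4 : |C / 4 * t ^ 4 * (w 0 ^ 2 + w 1 ^ 2 + w 2 ^ 2)| ≤ 3 / 2 * |C| * (V ^ 2 * t ^ 4 + K ^ 2 * t ^ 3) := by
    have e : C / 4 * t ^ 4 * (w 0 ^ 2 + w 1 ^ 2 + w 2 ^ 2) = C / 4 * (t ^ 4 * fpSq w) := by rw [hw']; ring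
    rw [e, abs_mul (C / 4), abs_div C 4, abs_of_pos (by norm_num : (0:ℝ) < 4),
      abs_of_nonneg (mul_nonneg (pow_nonneg ht0 4) hw0)]
    have h := mul_le_mul_of_nonneg_left a2 (abs_nonneg C)
    linarith
  have hsplit : fpNumI fS fA D C x w G = fS * (1 / 24 * t ^ 3 * fpSymSq G) + fA * (1 / 24 * t ^ 3 * (fpFrob G - fpSymSq G)) +
      (7 * D + C) / 4 * t ^ 5 * fpDot x w ^ 2 - C / 4 * t ^ 4 * (w 0 ^ 2 + w 1 ^ 2 + w 2 ^ 2) := by rw [ht]; rfl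
  rw [hsplit]
  calc |fS * (1 / 24 * t ^ 3 * fpSymSq G) + fA * (1 / 24 * t ^ 3 * (fpFrob G - fpSymSq G)) +
        (7 * D + C) / 4 * t ^ 5 * fpDot x w ^ 2 - C / 4 * t ^ 4 * (w 0 ^ 2 + w 1 ^ 2 + w 2 ^ 2)|
      ≤ |fS * (1 / 24 * t ^ 3 * fpSymSq G) + fA * (1 / 24 * t ^ 3 * (fpFrob G - fpSymSq G)) +
          (7 * D + C) / 4 * t ^ 5 * fpDot x w ^ 2| + |C / 4 * t ^ 4 * (w 0 ^ 2 + w 1 ^ 2 + w 2 ^ 2)| := abs_sub _ _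
    _ ≤ |fS * (1 / 24 * t ^ 3 * fpSymSq G)| + |fA * (1 / 24 * t ^ 3 * (fpFrob G - fpSymSq G))| +
          |(7 * D + C) / 4 * t ^ 5 * fpDot x w ^ 2| + |C / 4 * t ^ 4 * (w 0 ^ 2 + w 1 ^ 2 + w 2 ^ 2)| := by
        linarith [abs_add_three (fS * (1 / 24 * t ^ 3 * fpSymSq G)) (fA * (1 / 24 * t ^ 3 * (fpFrob G - fpSymSq G)))
          ((7 * D + C) / 4 * t ^ 5 * fpDot x w ^ 2)]
    _ ≤ (3 / 8 * (|fS| + |fA|) + 3 / 2 * (|7 * D + C| + |C|)) * K ^ 2 * t ^ 3 + 3 / 2 * (|7 * D + C| + |C|) * V ^ 2 * t ^ 4 := by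
        linarith

/-- **Generic flux bound**: `|Φⱼ(y)| ≤ (3|a| + 3|b| + 9|c|)|y|⁻⁸‖y‖W² + 6|n|K|y|⁻⁶W` when `|∂ᵢvⱼ(y)| ≤ K` and `‖v y‖ ≤ W`
(the radial flux `Φ₃ = |y|⁻¹⁰⟪y,v⟫²y` contributes `9|c|` after `|y|⁻²‖y‖² ≤ 1`). -/
theorem abs_fpFlux4_le (a b c n : ℝ) {v : (Fin 3 → ℝ) → (Fin 3 → ℝ)} {y : Fin 3 → ℝ} {K W : ℝ} (hK : 0 ≤ K) (hW : 0 ≤ W)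
    (hG : ∀ i j, |fpGrad v y i j| ≤ K) (hw : ‖v y‖ ≤ W) (j : Fin 3) :
    |fpFlux4 a b c n v y j| ≤
      (3 * |a| + 3 * |b| + 9 * |c|) * (fpSq y)⁻¹ ^ 4 * ‖y‖ * W ^ 2 + 6 * |n| * K * (fpSq y)⁻¹ ^ 3 * W := by
  set t := (fpSq y)⁻¹ with ht
  set w := v y with hw'
  set G := fpGrad v y with hG'
  have ht0 : 0 ≤ t := inv_nonneg.2 (fpSq_nonneg y)
  have hst : fpSq y * t ≤ 1 := fpSq_mul_inv_le_one y
  have hys : ‖y‖ ^ 2 ≤ fpSq y := norm_sq_le_fpSq y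
  have hyi : ∀ i, |y i| ≤ ‖y‖ := fun i => by simpa [Real.norm_eq_abs] using norm_le_pi_norm y i
  have hwi : ∀ i, |w i| ≤ W := fun i => le_trans (by simpa [Real.norm_eq_abs] using norm_le_pi_norm w i) hw
  have hy0 : 0 ≤ ‖y‖ := norm_nonneg _
  have hsqw : fpSq w ≤ 3 * W ^ 2 := le_trans (fpSq_le_three_mul_norm_sq w) (by nlinarith [norm_nonneg w])
  have hsqw0 : 0 ≤ fpSq w := fpSq_nonneg w
  have hdot : |fpDot y w| ≤ 3 * ‖y‖ * W := by
    unfold fpDot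
    have e : ∀ i, |y i * w i| ≤ ‖y‖ * W := fun i => by
      rw [abs_mul]; exact mul_le_mul (hyi i) (hwi i) (abs_nonneg _) (norm_nonneg _)
    calc |y 0 * w 0 + y 1 * w 1 + y 2 * w 2| ≤ |y 0 * w 0| + |y 1 * w 1| + |y 2 * w 2| := abs_add_three _ _ _
      _ ≤ 3 * ‖y‖ * W := by linarith [e 0, e 1, e 2]
  have htr : |fpTr G| ≤ 3 * K := by
    unfold fpTr
    calc |G 0 0 + G 1 1 + G 2 2| ≤ |G 0 0| + |G 1 1| + |G 2 2| := abs_add_three _ _ _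
      _ ≤ 3 * K := by linarith [hG 0 0, hG 1 1, hG 2 2]
  -- first bracket `a|w|²yⱼ + b⟪y,w⟫wⱼ`
  have b1 : |a * fpSq w * y j + b * fpDot y w * w j| ≤ (3 * |a| + 3 * |b|) * ‖y‖ * W ^ 2 := by
    have e1 : |a * fpSq w * y j| ≤ |a| * (3 * W ^ 2) * ‖y‖ := by
      rw [abs_mul, abs_mul, abs_of_nonneg hsqw0]
      exact mul_le_mul (mul_le_mul_of_nonneg_left hsqw (abs_nonneg _)) (hyi j) (abs_nonneg _) (by positivity)
    have e2 : |b * fpDot y w * w j| ≤ |b| * (3 * ‖y‖ * W) * W := by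
      rw [abs_mul, abs_mul]
      exact mul_le_mul (mul_le_mul_of_nonneg_left hdot (abs_nonneg _)) (hwi j) (abs_nonneg _) (by positivity)
    calc |a * fpSq w * y j + b * fpDot y w * w j| ≤ |a * fpSq w * y j| + |b * fpDot y w * w j| := abs_add_le _ _
      _ ≤ (3 * |a| + 3 * |b|) * ‖y‖ * W ^ 2 := by nlinarith
  -- radial bracket `t⁵⟪y,w⟫²yⱼ ≤ 9t⁴‖y‖W²`
  have b3 : |t ^ 5 * fpDot y w ^ 2 * y j| ≤ 9 * t ^ 4 * ‖y‖ * W ^ 2 := by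
    rw [abs_mul (t ^ 5 * fpDot y w ^ 2), abs_mul (t ^ 5), abs_of_nonneg (pow_nonneg ht0 5),
      abs_of_nonneg (sq_nonneg (fpDot y w))]
    have hd2 : fpDot y w ^ 2 ≤ (3 * ‖y‖ * W) ^ 2 := by
      rw [← sq_abs]; exact pow_le_pow_left₀ (abs_nonneg _) hdot 2
    have hty : t * ‖y‖ ^ 2 ≤ 1 := by nlinarith
    calc t ^ 5 * fpDot y w ^ 2 * |y j| ≤ t ^ 5 * (3 * ‖y‖ * W) ^ 2 * ‖y‖ := by gcongr; exact hyi j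
      _ = 9 * t ^ 4 * ‖y‖ * W ^ 2 * (t * ‖y‖ ^ 2) := by ring
      _ ≤ 9 * t ^ 4 * ‖y‖ * W ^ 2 * 1 := by gcongr
      _ = 9 * t ^ 4 * ‖y‖ * W ^ 2 := by ring
  -- Korn bracket
  have b2 : |w 0 * G 0 j + w 1 * G 1 j + w 2 * G 2 j - fpTr G * w j| ≤ 6 * K * W := by
    have e : ∀ i, |w i * G i j| ≤ W * K := fun i => by
      rw [abs_mul]; exact mul_le_mul (hwi i) (hG i j) (abs_nonneg _) hW
    have e4 : |fpTr G * w j| ≤ 3 * K * W := by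
      rw [abs_mul]; exact mul_le_mul htr (hwi j) (abs_nonneg _) (by positivity)
    calc |w 0 * G 0 j + w 1 * G 1 j + w 2 * G 2 j - fpTr G * w j|
        ≤ |w 0 * G 0 j + w 1 * G 1 j + w 2 * G 2 j| + |fpTr G * w j| := abs_sub _ _
      _ ≤ |w 0 * G 0 j| + |w 1 * G 1 j| + |w 2 * G 2 j| + |fpTr G * w j| := by
          linarith [abs_add_three (w 0 * G 0 j) (w 1 * G 1 j) (w 2 * G 2 j)]
      _ ≤ 6 * K * W := by linarith [e 0, e 1, e 2]
  have hsplit : fpFlux4 a b c n v y j = t ^ 4 * (a * fpSq w * y j + b * fpDot y w * w j) +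
      c * (t ^ 5 * fpDot y w ^ 2 * y j) + n * (t ^ 3 * (w 0 * G 0 j + w 1 * G 1 j + w 2 * G 2 j - fpTr G * w j)) := by
    rw [ht, hw', hG']; rfl
  rw [hsplit]
  calc |t ^ 4 * (a * fpSq w * y j + b * fpDot y w * w j) + c * (t ^ 5 * fpDot y w ^ 2 * y j) +
        n * (t ^ 3 * (w 0 * G 0 j + w 1 * G 1 j + w 2 * G 2 j - fpTr G * w j))|
      ≤ |t ^ 4 * (a * fpSq w * y j + b * fpDot y w * w j)| + |c * (t ^ 5 * fpDot y w ^ 2 * y j)| +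
          |n * (t ^ 3 * (w 0 * G 0 j + w 1 * G 1 j + w 2 * G 2 j - fpTr G * w j))| := abs_add_three _ _ _
    _ = t ^ 4 * |a * fpSq w * y j + b * fpDot y w * w j| + |c| * |t ^ 5 * fpDot y w ^ 2 * y j| +
          |n| * (t ^ 3 * |w 0 * G 0 j + w 1 * G 1 j + w 2 * G 2 j - fpTr G * w j|) := by
        rw [abs_mul (t ^ 4), abs_mul c, abs_mul n, abs_mul (t ^ 3), abs_of_nonneg (pow_nonneg ht0 4),
          abs_of_nonneg (pow_nonneg ht0 3)]
    _ ≤ t ^ 4 * ((3 * |a| + 3 * |b|) * ‖y‖ * W ^ 2) + |c| * (9 * t ^ 4 * ‖y‖ * W ^ 2) + |n| * (t ^ 3 * (6 * K * W)) := by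
        gcongr
    _ = (3 * |a| + 3 * |b| + 9 * |c|) * t ^ 4 * ‖y‖ * W ^ 2 + 6 * |n| * K * t ^ 3 * W := by ring

/-! ## Measurability of the three integrands for an arbitrary continuous field -/

section measurability
variable {v : (Fin 3 → ℝ) → (Fin 3 → ℝ)} {χ : (Fin 3 → ℝ) → ℝ}

/-- The demand integrand `χ²·N(f_S,f_A,D,C)(x, v, ∇v)` is measurable for continuous `v`, `χ`. -/
theorem measurable_chiSq_mul_fpNumI (fS fA D C : ℝ) (hv : Continuous v) (hχ : Continuous χ) :
    Measurable fun x => χ x ^ 2 * fpNumI fS fA D C x (v x) (fpGrad v x) := by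
  have hg := measurable_fpGrad_apply v
  have hvi : ∀ i, Measurable fun x => v x i := fun i => (continuous_apply i).measurable.comp hv.measurable
  have hxi : ∀ i : Fin 3, Measurable fun x : Fin 3 → ℝ => x i := fun i => measurable_pi_apply i
  have hs := measurable_fpSq_inv
  have hsym : Measurable fun x => fpSymSq (fpGrad v x) := by
    unfold fpSymSq; fun_prop
  have hfrob : Measurable fun x => fpFrob (fpGrad v x) := by
    unfold fpFrob; fun_prop
  have hdot : Measurable fun x => fpDot x (v x) := by
    unfold fpDot; fun_prop
  have hvs : Measurable fun x => v x 0 ^ 2 + v x 1 ^ 2 + v x 2 ^ 2 := by fun_prop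
  have h : Measurable fun x => χ x ^ 2 * (fS * (1 / 24 * (fpSq x)⁻¹ ^ 3 * fpSymSq (fpGrad v x)) +
      fA * (1 / 24 * (fpSq x)⁻¹ ^ 3 * (fpFrob (fpGrad v x) - fpSymSq (fpGrad v x))) +
      (7 * D + C) / 4 * (fpSq x)⁻¹ ^ 5 * fpDot x (v x) ^ 2 - C / 4 * (fpSq x)⁻¹ ^ 4 * (v x 0 ^ 2 + v x 1 ^ 2 + v x 2 ^ 2)) := by
    fun_prop
  exact h

/-- Each generic flux component `Φⱼ(v)(x)` is measurable for continuous `v`. -/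
theorem measurable_fpFlux4 (a b c n : ℝ) (hv : Continuous v) (j : Fin 3) : Measurable fun x => fpFlux4 a b c n v x j := by
  have hg := measurable_fpGrad_apply v
  have hvi : ∀ i, Measurable fun x => v x i := fun i => (continuous_apply i).measurable.comp hv.measurable
  have hxi : ∀ i : Fin 3, Measurable fun x : Fin 3 → ℝ => x i := fun i => measurable_pi_apply i
  have hs := measurable_fpSq_inv
  have hdot : Measurable fun x => fpDot x (v x) := by
    unfold fpDot; fun_prop
  have hvs : Measurable fun x => fpSq (v x) := by unfold fpSq; fun_prop
  have htr : Measurable fun x => fpTr (fpGrad v x) := by unfold fpTr; fun_prop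
  have h : Measurable fun x => (fpSq x)⁻¹ ^ 4 * (a * fpSq (v x) * x j + b * fpDot x (v x) * v x j) +
      c * ((fpSq x)⁻¹ ^ 5 * fpDot x (v x) ^ 2 * x j) +
      n * ((fpSq x)⁻¹ ^ 3 * (v x 0 * fpGrad v x 0 j + v x 1 * fpGrad v x 1 j + v x 2 * fpGrad v x 2 j -
        fpTr (fpGrad v x) * v x j)) := by
    fun_prop
  exact h

/-- The interface integrand `2χ⟪∇χ, Φ(v)⟫` is measurable for continuous `v` and `C²` `χ` (generic flux). -/
theorem measurable_two_chi_flux4DotGrad (a b c n : ℝ) (hv : Continuous v) (hχ : ContDiff ℝ 2 χ) :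
    Measurable fun x => 2 * χ x * fpFlux4DotGrad a b c n v χ x := by
  have hf := measurable_fpFlux4 a b c n hv
  have hgs : ∀ j, Measurable fun x => fpGradS χ x j := fun j => (continuous_fpGradS hχ j).measurable
  have hc : Measurable χ := hχ.continuous.measurable
  have h : Measurable fun x => 2 * χ x * (fpGradS χ x 0 * fpFlux4 a b c n v x 0 + fpGradS χ x 1 * fpFlux4 a b c n v x 1 +
      fpGradS χ x 2 * fpFlux4 a b c n v x 2) := by
    fun_prop
  exact h

end measurability

/-! ## The generic far pencil for the P1 class -/

/-- **Weighted far pencil for a GENERIC pointwise certificate on Lipschitz fields that are locally affine off a null set and affine outside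
a ball (the P1 class).**  Let `N(f_S,f_A,D,C) + div(aΦ₁ + bΦ₂ + cΦ₃ + nΨ₁) ≤ t·Den` hold at every `x ≠ 0`.  Let `v : ℝ³ → ℝ³` be
`K`-Lipschitz, affine (`v = b₀ + y·A`) for `‖y‖ ≥ R`, and near every point outside a null set `S` equal to an affine map on a ball; let
`χ ∈ C²` vanish near `0` and equal `1` for `‖y‖ ≥ R`.  Then, with `∇v := fderiv` (the honest element gradient off `S`),
`∫ χ²·N(v) ≤ t·∫ χ²·Den(v) + ∫ 2χ⟪∇χ, Φ(v)⟫`.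
Proof: mollify, apply `farPencil4_weighted_integral_le_of_affineTail`, dominated convergence (`abs_fpNumI_le` / `abs_fpDen_le` /
`abs_fpFlux4_le`).  NOT a proof of H12⋆, NOT summit progress. -/
theorem farPencil4_weighted_integral_le_of_locallyAffine {fS fA D C a b c n t : ℝ}
    (hcert : ∀ (x v : Fin 3 → ℝ) (G : Fin 3 → Fin 3 → ℝ), x ≠ 0 → fpNumI fS fA D C x v G + fpDivFlux4 a b c n x v G ≤ t * fpDen x G)
    {v : (Fin 3 → ℝ) → (Fin 3 → ℝ)} {χ : (Fin 3 → ℝ) → ℝ} {K : ℝ≥0}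
    {R : ℝ} {b₀ : Fin 3 → ℝ} {A : Fin 3 → Fin 3 → ℝ} {S : Set (Fin 3 → ℝ)} (hv : LipschitzWith K v) (hS : volume S = 0)
    (hloc : ∀ x, x ∉ S → ∃ r > 0, ∃ L : (Fin 3 → ℝ) →L[ℝ] (Fin 3 → ℝ), ∀ y ∈ ball x r, v y = v x + L (y - x))
    (hχ : ContDiff ℝ 2 χ) (hχ0 : (0 : Fin 3 → ℝ) ∉ tsupport χ)
    (htail : ∀ y : Fin 3 → ℝ, R ≤ ‖y‖ → ∀ j, v y j = b₀ j + (y 0 * A 0 j + y 1 * A 1 j + y 2 * A 2 j))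
    (hχ1 : ∀ y : Fin 3 → ℝ, R ≤ ‖y‖ → χ y = 1) :
    ∫ x, χ x ^ 2 * fpNumI fS fA D C x (v x) (fpGrad v x) ≤
      t * (∫ x, χ x ^ 2 * fpDen x (fpGrad v x)) + ∫ x, 2 * χ x * fpFlux4DotGrad a b c n v χ x := by
  -- the bump sequence `rOut = 1/(n+1)`
  let φ : ℕ → ContDiffBump (0 : Fin 3 → ℝ) := fun m =>
    ⟨1 / (2 * ((m : ℝ) + 1)), 1 / ((m : ℝ) + 1), by positivity,
      one_div_lt_one_div_of_lt (by positivity) (by linarith)⟩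
  have hφout : ∀ m, (φ m).rOut = 1 / ((m : ℝ) + 1) := fun m => rfl
  have hφle1 : ∀ m, (φ m).rOut ≤ 1 := fun m => by
    rw [hφout, div_le_one (by positivity)]; linarith [(Nat.cast_nonneg m : (0 : ℝ) ≤ m)]
  have hφto : Tendsto (fun m => (φ m).rOut) atTop (𝓝 0) := by
    simp only [hφout]; exact tendsto_one_div_add_atTop_nhds_zero_nat
  let u : ℕ → (Fin 3 → ℝ) → (Fin 3 → ℝ) := fun m => (φ m).normed volume ⋆[lsmul ℝ ℝ, volume] v
  have hvc : Continuous v := hv.continuous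
  have hu2 : ∀ m, ContDiff ℝ 2 (u m) := fun m => normed_convolution_smooth (φ m) hvc
  have huc : ∀ m, Continuous (u m) := fun m => (hu2 m).continuous
  have hutail : ∀ m, ∀ y : Fin 3 → ℝ, R + 1 ≤ ‖y‖ → ∀ j, u m y j = b₀ j + (y 0 * A 0 j + y 1 * A 1 j + y 2 * A 2 j) :=
    fun m y hy j => mollify_affineTail (φ m) htail y (by linarith [hφle1 m]) j
  have hχ1' : ∀ y : Fin 3 → ℝ, R + 1 ≤ ‖y‖ → χ y = 1 := fun y hy => hχ1 y (by linarith)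
  -- the `C²` far theorem along the sequence
  have hfar : ∀ m, ∫ x, χ x ^ 2 * fpNumI fS fA D C x (u m x) (fpGrad (u m) x) ≤
      t * (∫ x, χ x ^ 2 * fpDen x (fpGrad (u m) x)) + ∫ x, 2 * χ x * fpFlux4DotGrad a b c n (u m) χ x :=
    fun m => farPencil4_weighted_integral_le_of_affineTail hcert (hu2 m) hχ hχ0 (hutail m) hχ1'
  -- uniform bounds: `|∂(u m)| ≤ K`, `‖u m x‖ ≤ V + K‖x‖` with `V = ‖v 0‖ + K`
  set V : ℝ := ‖v 0‖ + K with hV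
  have hK0 : (0 : ℝ) ≤ K := K.2
  have hV0 : 0 ≤ V := by positivity
  have hGn : ∀ m x i j, |fpGrad (u m) x i j| ≤ K := fun m x i j => abs_fpGrad_normed_convolution_le (φ m) hv x i j
  have hwn : ∀ m x, ‖u m x‖ ≤ V + K * ‖x‖ := fun m x => by
    have h1 := norm_normed_convolution_le (φ m) hv x
    have h2 := norm_le_of_lipschitz hv x
    have h3 : (K : ℝ) * (φ m).rOut ≤ K := by nlinarith [hφle1 m, (φ m).rOut_pos]
    rw [hV]; linarith
  -- pointwise eventual equality off `S`
  have hev : ∀ x, x ∉ S → ∀ᶠ m in atTop, u m x = v x ∧ fpGrad (u m) x = fpGrad v x := by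
    intro x hx
    obtain ⟨r, hr, L, hL⟩ := hloc x hx
    have hm : ∀ᶠ m in atTop, (φ m).rOut < r := (tendsto_order.1 hφto).2 r hr
    filter_upwards [hm] with m hm
    refine ⟨normed_convolution_apply_eq_of_affine_near (φ m) L hL hm, ?_⟩
    funext i j
    unfold fpGrad
    rw [fderiv_normed_convolution_eq_of_affine_near (φ m) L hL hm]
  have hae : ∀ᵐ x ∂(volume : Measure (Fin 3 → ℝ)), x ∉ S := measure_eq_zero_iff_ae_notMem.1 hS
  -- (1) demand integrals converge
  have hlimN : Tendsto (fun m => ∫ x, χ x ^ 2 * fpNumI fS fA D C x (u m x) (fpGrad (u m) x)) atTop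
      (𝓝 (∫ x, χ x ^ 2 * fpNumI fS fA D C x (v x) (fpGrad v x))) := by
    refine tendsto_integral_of_dominated_convergence
      (fun x => χ x ^ 2 * ((3 / 8 * (|fS| + |fA|) + 3 / 2 * (|7 * D + C| + |C|)) * (K : ℝ) ^ 2 * (fpSq x)⁻¹ ^ 3 +
        3 / 2 * (|7 * D + C| + |C|) * V ^ 2 * (fpSq x)⁻¹ ^ 4))
      (fun m => (measurable_chiSq_mul_fpNumI fS fA D C (huc m) hχ.continuous).aestronglyMeasurable)
      (integrable_chiSq_mul_invPow hχ hχ0 hχ1 _ _) (fun m => ae_of_all _ fun x => ?_) ?_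
    · rw [Real.norm_eq_abs, abs_mul, abs_of_nonneg (sq_nonneg _)]
      exact mul_le_mul_of_nonneg_left (abs_fpNumI_le fS fA D C (hGn m x) (hwn m x)) (sq_nonneg _)
    · filter_upwards [hae] with x hx
      refine (tendsto_const_nhds (x := χ x ^ 2 * fpNumI fS fA D C x (v x) (fpGrad v x))).congr' ?_
      filter_upwards [hev x hx] with m hm
      rw [hm.1, hm.2]
  -- (2) receipt integrals converge
  have hlimD : Tendsto (fun m => ∫ x, χ x ^ 2 * fpDen x (fpGrad (u m) x)) atTop
      (𝓝 (∫ x, χ x ^ 2 * fpDen x (fpGrad v x))) := by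
    refine tendsto_integral_of_dominated_convergence
      (fun x => χ x ^ 2 * (108 / 5 * (K : ℝ) ^ 2 * (fpSq x)⁻¹ ^ 3 + 0 * (fpSq x)⁻¹ ^ 4))
      (fun m => (measurable_chiSq_mul_fpDen (v := u m) hχ.continuous).aestronglyMeasurable)
      (integrable_chiSq_mul_invPow hχ hχ0 hχ1 _ _) (fun m => ae_of_all _ fun x => ?_) ?_
    · rw [Real.norm_eq_abs, abs_mul, abs_of_nonneg (sq_nonneg _), zero_mul, add_zero]
      exact mul_le_mul_of_nonneg_left (abs_fpDen_le (hGn m x)) (sq_nonneg _)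
    · filter_upwards [hae] with x hx
      refine (tendsto_const_nhds (x := χ x ^ 2 * fpDen x (fpGrad v x))).congr' ?_
      filter_upwards [hev x hx] with m hm
      rw [hm.2]
  -- (3) flux integrals converge
  have hlimF : Tendsto (fun m => ∫ x, 2 * χ x * fpFlux4DotGrad a b c n (u m) χ x) atTop
      (𝓝 (∫ x, 2 * χ x * fpFlux4DotGrad a b c n v χ x)) := by
    refine tendsto_integral_of_dominated_convergence
      (fun x => (|2 * χ x * fpGradS χ x 0| + |2 * χ x * fpGradS χ x 1| + |2 * χ x * fpGradS χ x 2|) *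
        ((3 * |a| + 3 * |b| + 9 * |c|) * (fpSq x)⁻¹ ^ 4 * ‖x‖ * (V + K * ‖x‖) ^ 2 +
          6 * |n| * K * (fpSq x)⁻¹ ^ 3 * (V + K * ‖x‖)))
      (fun m => (measurable_two_chi_flux4DotGrad a b c n (huc m) hχ).aestronglyMeasurable)
      (integrable_fluxBound hχ hχ0 hχ1 (6 * |n|) (3 * |a| + 3 * |b| + 9 * |c|) K V) (fun m => ae_of_all _ fun x => ?_) ?_
    · have hB : ∀ j, |fpFlux4 a b c n (u m) x j| ≤ (3 * |a| + 3 * |b| + 9 * |c|) * (fpSq x)⁻¹ ^ 4 * ‖x‖ * (V + K * ‖x‖) ^ 2 +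
          6 * |n| * K * (fpSq x)⁻¹ ^ 3 * (V + K * ‖x‖) :=
        fun j => abs_fpFlux4_le a b c n hK0 (by nlinarith [norm_nonneg x]) (hGn m x) (hwn m x) j
      set B := (3 * |a| + 3 * |b| + 9 * |c|) * (fpSq x)⁻¹ ^ 4 * ‖x‖ * (V + K * ‖x‖) ^ 2 +
          6 * |n| * K * (fpSq x)⁻¹ ^ 3 * (V + K * ‖x‖) with hBdef
      have hB0 : 0 ≤ B := le_trans (abs_nonneg _) (hB 0)
      rw [Real.norm_eq_abs]
      unfold fpFlux4DotGrad
      have e : ∀ j, |2 * χ x * (fpGradS χ x j * fpFlux4 a b c n (u m) x j)| ≤ |2 * χ x * fpGradS χ x j| * B := fun j => by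
        rw [← mul_assoc, abs_mul]
        exact mul_le_mul_of_nonneg_left (hB j) (abs_nonneg _)
      calc |2 * χ x * (fpGradS χ x 0 * fpFlux4 a b c n (u m) x 0 + fpGradS χ x 1 * fpFlux4 a b c n (u m) x 1 +
            fpGradS χ x 2 * fpFlux4 a b c n (u m) x 2)|
          = |2 * χ x * (fpGradS χ x 0 * fpFlux4 a b c n (u m) x 0) + 2 * χ x * (fpGradS χ x 1 * fpFlux4 a b c n (u m) x 1) +
              2 * χ x * (fpGradS χ x 2 * fpFlux4 a b c n (u m) x 2)| := by ring_nf
        _ ≤ |2 * χ x * (fpGradS χ x 0 * fpFlux4 a b c n (u m) x 0)| + |2 * χ x * (fpGradS χ x 1 * fpFlux4 a b c n (u m) x 1)| +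
              |2 * χ x * (fpGradS χ x 2 * fpFlux4 a b c n (u m) x 2)| := abs_add_three _ _ _
        _ ≤ |2 * χ x * fpGradS χ x 0| * B + |2 * χ x * fpGradS χ x 1| * B + |2 * χ x * fpGradS χ x 2| * B := by
              linarith [e 0, e 1, e 2]
        _ = (|2 * χ x * fpGradS χ x 0| + |2 * χ x * fpGradS χ x 1| + |2 * χ x * fpGradS χ x 2|) * B := by ring
    · filter_upwards [hae] with x hx
      refine (tendsto_const_nhds (x := 2 * χ x * fpFlux4DotGrad a b c n v χ x)).congr' ?_
      filter_upwards [hev x hx] with m hm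
      have hf : ∀ j, fpFlux4 a b c n (u m) x j = fpFlux4 a b c n v x j := fun j => by
        unfold fpFlux4; rw [hm.1, hm.2]
      unfold fpFlux4DotGrad
      rw [hf 0, hf 1, hf 2]
  -- pass to the limit in the inequality
  have hlimR : Tendsto (fun m => t * (∫ x, χ x ^ 2 * fpDen x (fpGrad (u m) x)) +
      ∫ x, 2 * χ x * fpFlux4DotGrad a b c n (u m) χ x)
      atTop (𝓝 (t * (∫ x, χ x ^ 2 * fpDen x (fpGrad v x)) + ∫ x, 2 * χ x * fpFlux4DotGrad a b c n v χ x)) :=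
    (hlimD.const_mul _).add hlimF
  exact le_of_tendsto_of_tendsto' hlimN hlimR hfar

/-- **Instance: the recommended inflated certificate D on the P1 class** — the continuum far theorem the H12⋆ assembly consumes for the
piecewise-affine interpolant of a lattice displacement (HOME CERT.md §23 (6); FAR-LEMMA-SPEC §14 (e)): for `v` `K`-Lipschitz, locally
affine off a null set, affine for `‖y‖ ≥ R`, and `χ ∈ C²` with `0 ∉ tsupport χ`, `χ = 1` for `‖y‖ ≥ R`,
`∫ χ²·N(7/4,7/4,6/5,9/10)(v) ≤ (9/40)·∫ χ²·Den(v) + ∫ 2χ⟪∇χ, Φ_D(v)⟫`, `Φ_D = (7/45)Φ₁ + (23/30)Φ₂ − (19/40)Φ₃ + (3/40)Ψ₁`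
(near flux channels `(a, b+c, n₁) = (7/45, 7/24, 3/40)`).  NOT a proof of H12⋆, NOT summit progress. -/
theorem farPencilD_weighted_integral_le_of_locallyAffine {v : (Fin 3 → ℝ) → (Fin 3 → ℝ)} {χ : (Fin 3 → ℝ) → ℝ} {K : ℝ≥0}
    {R : ℝ} {b₀ : Fin 3 → ℝ} {A : Fin 3 → Fin 3 → ℝ} {S : Set (Fin 3 → ℝ)} (hv : LipschitzWith K v) (hS : volume S = 0)
    (hloc : ∀ x, x ∉ S → ∃ r > 0, ∃ L : (Fin 3 → ℝ) →L[ℝ] (Fin 3 → ℝ), ∀ y ∈ ball x r, v y = v x + L (y - x))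
    (hχ : ContDiff ℝ 2 χ) (hχ0 : (0 : Fin 3 → ℝ) ∉ tsupport χ)
    (htail : ∀ y : Fin 3 → ℝ, R ≤ ‖y‖ → ∀ j, v y j = b₀ j + (y 0 * A 0 j + y 1 * A 1 j + y 2 * A 2 j))
    (hχ1 : ∀ y : Fin 3 → ℝ, R ≤ ‖y‖ → χ y = 1) :
    ∫ x, χ x ^ 2 * fpNumI (7 / 4) (7 / 4) (6 / 5) (9 / 10) x (v x) (fpGrad v x) ≤
      9 / 40 * (∫ x, χ x ^ 2 * fpDen x (fpGrad v x)) +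
        ∫ x, 2 * χ x * fpFlux4DotGrad (7 / 45) (23 / 30) (-(19 / 40)) (3 / 40) v χ x :=
  farPencil4_weighted_integral_le_of_locallyAffine farPencilCert_D hv hS hloc hχ hχ0 htail hχ1

/-- **Instance: the conservative certificate B on the P1 class** (`…FarPencilInflatedB`: `(16/5,16/5,5/4,3/4)`, `t = 27/50` — the
all-kernel route that books the true-β inflation per bond against the BASE radius via `h1_tau_inflation_num`, HOME CERT.md §23 (6)):
`∫ χ²·N(16/5,16/5,5/4,3/4)(v) ≤ (27/50)·∫ χ²·Den(v) + ∫ 2χ⟪∇χ, Φ_B(v)⟫`, `Φ_B = (259/720)Φ₁ + (1111/720)Φ₂ − (413/360)Φ₃ + (247/1800)Ψ₁`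
(near flux channels `(a, b+c, n₁) = (259/720, 19/48, 247/1800)`).  NOT a proof of H12⋆, NOT summit progress. -/
theorem farPencilB_weighted_integral_le_of_locallyAffine {v : (Fin 3 → ℝ) → (Fin 3 → ℝ)} {χ : (Fin 3 → ℝ) → ℝ} {K : ℝ≥0}
    {R : ℝ} {b₀ : Fin 3 → ℝ} {A : Fin 3 → Fin 3 → ℝ} {S : Set (Fin 3 → ℝ)} (hv : LipschitzWith K v) (hS : volume S = 0)
    (hloc : ∀ x, x ∉ S → ∃ r > 0, ∃ L : (Fin 3 → ℝ) →L[ℝ] (Fin 3 → ℝ), ∀ y ∈ ball x r, v y = v x + L (y - x))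
    (hχ : ContDiff ℝ 2 χ) (hχ0 : (0 : Fin 3 → ℝ) ∉ tsupport χ)
    (htail : ∀ y : Fin 3 → ℝ, R ≤ ‖y‖ → ∀ j, v y j = b₀ j + (y 0 * A 0 j + y 1 * A 1 j + y 2 * A 2 j))
    (hχ1 : ∀ y : Fin 3 → ℝ, R ≤ ‖y‖ → χ y = 1) :
    ∫ x, χ x ^ 2 * fpNumI (16 / 5) (16 / 5) (5 / 4) (3 / 4) x (v x) (fpGrad v x) ≤
      27 / 50 * (∫ x, χ x ^ 2 * fpDen x (fpGrad v x)) +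
        ∫ x, 2 * χ x * fpFlux4DotGrad (259 / 720) (1111 / 720) (-(413 / 360)) (247 / 1800) v χ x :=
  farPencil4_weighted_integral_le_of_locallyAffine farPencilCert_B hv hS hloc hχ hχ0 htail hχ1

end Summit.AtomisticToContinuum.Crystallization.Theorems.StrictSplittingRuleBirth
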